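import Summits.CriticalPhenomena.PercolationContinuityZ3.Theorems.PercNearOneGluingNoHeavyLowerTailKNConj4AllWeights
import Literature.Barriers.PneNP.TSPExtensionComplexityFarkas
import HarnessLib

/-!
# `NoHeavyLowerTail` (stmt-CriticalPhenomena-4575) — UNIVERSAL gluing coefficients: one probability vector on the relay set serves every
# increasing cluster event (Kozma–Nitzan Conjecture 4 with target-free coefficients, by LP duality)

Support file (`--supports stmt-CriticalPhenomena-4575`), prover `prim-ineq-gen-7` (gen 7).  No definitions, no named facts, no sorries; standard axioms.

Kozma–Nitzan (arXiv:2401.12397) CONJECTURE 4 (p. 32) — a tree theorem for every finite weighted graph, `PreFKGSurplus.kn_conj4` — says that for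
every monotone cluster property `F` SOME relay `a ∈ A` (depending on `F`) has `E[F(C_a); 0 ↔ A] ≤ E[F(C_0); 0 ↔ A]`; their QUESTION 5 (p. 32) asks for
coefficients `c_a ≥ 0`, `Σ c_a = 1`, serving all targets `b` at once in Conjecture 2.  THIS FILE proves the common strengthening for increasing
cluster EVENTS: for every finite weighted graph, every `A ≠ ∅` and every `0` there is ONE probability vector `c` on `A` with
`Σ_{a∈A} c_a · P(C_a ∈ 𝒰, 0 ↔ A) ≤ P(C_0 ∈ 𝒰, 0 ↔ A)` for EVERY up-set `𝒰` of vertex sets (`UniversalGluing.universal_upset_coefficients`);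
Question 5 is the case `𝒰 = {S ∋ b}` (`UniversalGluing.kn_question5_of_universal`, printed form `UniversalGluing.kn_question5` — QUESTION 5 ANSWERED: YES),
and by the layer-cake decomposition the same `c` serves EVERY monotone cluster property `F` (`UniversalGluing.universal_coefficients`):
`Σ_{a∈A} c_a · E[F(C_a); 0 ↔ A] ≤ E[F(C_0); 0 ↔ A]` — Conjecture 4 with the `min` replaced by a fixed `F`-independent average.
Proof: the finite two-person zero-sum game (rows `a ∈ A`, columns the up-sets `𝒰`, payoff `P(C_0 ∈ 𝒰; 0↔A) − P(C_a ∈ 𝒰; 0↔A)`) has value `≥ 0`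
because for every mixed column strategy `λ` the functional `F_λ = Σ_𝒰 λ_𝒰 1_𝒰` is monotone and Conjecture 4 supplies a good row; LP duality is the
tree's conic Farkas lemma `Literature.Barriers.PneNP.farkas` (generators `(P(C_a ∈ ·; 0↔A), 1)` and slack units, target `(P(C_0 ∈ ·; 0↔A), 1)`).
[cite: KozmaNitzan2024, Conj. 4 and Question 5 (p. 32)] [cite: FioriniEtAl2015, Lemma 2 (Farkas)]
-/

noncomputable section

namespace Summit.CriticalPhenomena.PercolationContinuityZ3.Theorems

open MeasureTheory Set Literature.Probability.LatticeModels Literature.Probability.Percolation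
open scoped Classical

namespace UniversalGluing

variable {n : ℕ}

/-- The up-sets of vertex sets (increasing cluster events), a finite type. [folklore] -/
abbrev UpSet (n : ℕ) : Type := {𝒰 : Set (Set (Fin n)) // IsUpperSet 𝒰}

/-- A nonnegative mixture of up-set indicators is a monotone cluster functional. [folklore] -/
theorem mixture_mono (lam : UpSet n → ℝ) (hlam : ∀ U, 0 ≤ lam U) (S T : Set (Fin n)) (hST : S ⊆ T) :
    (∑ U, lam U * (if S ∈ U.1 then (1 : ℝ) else 0)) ≤ ∑ U, lam U * (if T ∈ U.1 then (1 : ℝ) else 0) := by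
  refine Finset.sum_le_sum fun U _ => mul_le_mul_of_nonneg_left ?_ (hlam U)
  by_cases hS : S ∈ U.1
  · simp [hS, U.2 hST hS]
  · by_cases hT : T ∈ U.1
    · simp [hS, hT]
    · simp [hS, hT]

/-- `E[Σ_𝒰 λ_𝒰 1{C_x ∈ 𝒰}; W] = Σ_𝒰 λ_𝒰 · μ(W ∩ {C_x ∈ 𝒰})`. [folklore] -/
theorem setIntegral_mixture (w : Sym2 (Fin n) → unitInterval) (W : Set (BondConfig (Fin n))) (lam : UpSet n → ℝ) (x : Fin n) :
    ∫ ω in W, (∑ U, lam U * (if openCluster ω x ∈ U.1 then (1 : ℝ) else 0)) ∂(prodBernoulli w) =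
      ∑ U, lam U * (prodBernoulli w).real (W ∩ {ω | openCluster ω x ∈ U.1}) := by
  set μ := prodBernoulli w with hμ
  have hint : ∀ (g : BondConfig (Fin n) → ℝ), Integrable g (μ.restrict W) := fun g => Integrable.of_finite
  rw [integral_finsetSum _ fun U _ => hint _]
  refine Finset.sum_congr rfl fun U _ => ?_
  rw [integral_const_mul]
  congr 1
  have hind : (fun ω : BondConfig (Fin n) => (if openCluster ω x ∈ U.1 then (1 : ℝ) else 0)) =
      ({ω : BondConfig (Fin n) | openCluster ω x ∈ U.1} : Set (BondConfig (Fin n))).indicator 1 := by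
    funext ω
    by_cases h : ω ∈ ({ω : BondConfig (Fin n) | openCluster ω x ∈ U.1} : Set (BondConfig (Fin n)))
    · rw [indicator_of_mem h, Pi.one_apply, if_pos (show openCluster ω x ∈ U.1 from h)]
    · rw [indicator_of_notMem h, if_neg (show openCluster ω x ∉ U.1 from h)]
  rw [hind, KNPreFKG.setIntegral_indicator_one_eq]

/-- **UNIVERSAL GLUING COEFFICIENTS.**  On every finite graph with any weight vector in `[0,1]^E`, for every relay set `A ≠ ∅` and every source `0`
there is a probability vector `c` on `A` — the same for all events — with `Σ_{a∈A} c_a · P(C_a ∈ 𝒰, 0 ↔ A) ≤ P(C_0 ∈ 𝒰, 0 ↔ A)` for EVERY increasing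
family `𝒰` of vertex sets.  (Kozma–Nitzan's Conjecture 4 with target-free coefficients; LP duality — the tree's conic Farkas lemma — over the finite
game `A × {up-sets}`, fed by `PreFKGSurplus.kn_conj4` for mixtures of up-set indicators.)
[cite: KozmaNitzan2024, Conj. 4 and Question 5 (p. 32)] [cite: FioriniEtAl2015, Lemma 2 (Farkas)] -/
theorem universal_upset_coefficients (w : Sym2 (Fin n) → unitInterval) (A : Finset (Fin n)) (o : Fin n) (hA : A.Nonempty) :
    ∃ c : Fin n → ℝ, (∀ a, 0 ≤ c a) ∧ ∑ a ∈ A, c a = 1 ∧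
      ∀ 𝒰 : Set (Set (Fin n)), IsUpperSet 𝒰 →
        ∑ a ∈ A, c a * (prodBernoulli w).real ({ω | openCluster ω a ∈ 𝒰} ∩ ⋃ a' ∈ A, openConn o a') ≤
          (prodBernoulli w).real ({ω | openCluster ω o ∈ 𝒰} ∩ ⋃ a' ∈ A, openConn o a') := by
  set μ := prodBernoulli w with hμ
  set W : Set (BondConfig (Fin n)) := ⋃ a' ∈ A, openConn o a' with hW
  set K : Fin n → UpSet n → ℝ := fun a U => μ.real ({ω | openCluster ω a ∈ U.1} ∩ W) with hK
  set R : UpSet n → ℝ := fun U => μ.real ({ω | openCluster ω o ∈ U.1} ∩ W) with hR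
  let gen : (↥A ⊕ UpSet n) → (UpSet n ⊕ Unit) → ℝ := fun g =>
    match g with
    | Sum.inl a => Sum.elim (fun U => K a U) (fun _ => 1)
    | Sum.inr U₀ => Sum.elim (Pi.single U₀ 1) (fun _ => 0)
  let tgt : (UpSet n ⊕ Unit) → ℝ := Sum.elim R (fun _ => 1)
  rcases Literature.Barriers.PneNP.farkas gen tgt with ⟨lam, hlam, hfeas⟩ | ⟨y, hy, hty⟩
  · refine ⟨fun a => if h : a ∈ A then lam (Sum.inl ⟨a, h⟩) else 0, fun a => ?_, ?_, fun 𝒰 h𝒰 => ?_⟩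
    · by_cases h : a ∈ A
      · simp only [h, dif_pos]; exact hlam _
      · simp only [h, dif_neg, not_false_eq_true, le_refl]
    · have h1 := hfeas (Sum.inr ())
      simp only [tgt, gen, Sum.elim_inr, Fintype.sum_sum_type, mul_one, mul_zero, Finset.sum_const_zero, add_zero] at h1
      rw [h1, ← Finset.sum_coe_sort A]
      refine Finset.sum_congr rfl fun a _ => ?_
      simp only [a.2, dif_pos]
    · set U : UpSet n := ⟨𝒰, h𝒰⟩ with hU
      have hb := hfeas (Sum.inl U)
      simp only [tgt, gen, Sum.elim_inl, Fintype.sum_sum_type] at hb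
      have hslack : ∑ U₀ : UpSet n, lam (Sum.inr U₀) * (Pi.single U₀ (1 : ℝ) : UpSet n → ℝ) U = lam (Sum.inr U) := by
        rw [Finset.sum_eq_single U]
        · simp
        · intro U₀ _ hU₀; simp [Ne.symm hU₀]
        · intro h; exact absurd (Finset.mem_univ U) h
      rw [hslack] at hb
      have hrel : ∑ a ∈ A, (if h : a ∈ A then lam (Sum.inl ⟨a, h⟩) else 0) * μ.real ({ω | openCluster ω a ∈ 𝒰} ∩ W) =
          ∑ a : ↥A, lam (Sum.inl a) * K a U := by
        rw [← Finset.sum_coe_sort A]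
        refine Finset.sum_congr rfl fun a _ => ?_
        simp only [a.2, dif_pos, hK]
        rfl
      show ∑ a ∈ A, (if h : a ∈ A then lam (Sum.inl ⟨a, h⟩) else 0) * μ.real ({ω | openCluster ω a ∈ 𝒰} ∩ W) ≤ R U
      rw [hrel, hb]
      linarith [hlam (Sum.inr U)]
  · exfalso
    set lamb : UpSet n → ℝ := fun U => y (Sum.inl U) with hlamb
    set t : ℝ := y (Sum.inr ()) with ht
    have hdot : ∀ v : (UpSet n ⊕ Unit) → ℝ, dotProduct v y = ∑ U, v (Sum.inl U) * lamb U + v (Sum.inr ()) * t := by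
      intro v
      simp only [dotProduct, Fintype.sum_sum_type, Finset.univ_unique, PUnit.default_eq_unit, Finset.sum_singleton, hlamb, ht]
    have hlamb0 : ∀ U, 0 ≤ lamb U := by
      intro U
      have h := hy (Sum.inr U)
      rw [hdot] at h
      simp only [gen, Sum.elim_inl, Sum.elim_inr, zero_mul, add_zero] at h
      rw [Finset.sum_eq_single U] at h
      · simpa using h
      · intro U₀ _ hU₀; simp [hU₀]
      · intro h'; exact absurd (Finset.mem_univ U) h'
    have hrelay : ∀ a : ↥A, 0 ≤ ∑ U, K a U * lamb U + t := by
      intro a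
      have h := hy (Sum.inl a)
      rw [hdot] at h
      simpa [gen] using h
    have htgt : ∑ U, R U * lamb U + t < 0 := by
      have h := hty
      rw [hdot] at h
      simpa [tgt] using h
    obtain ⟨a, haA, hle⟩ := PreFKGSurplus.kn_conj4 w A o (fun S => ∑ U, lamb U * (if S ∈ U.1 then (1 : ℝ) else 0))
      (mixture_mono lamb hlamb0) hA
    rw [setIntegral_mixture w W lamb a, setIntegral_mixture w W lamb o] at hle
    have hKa : ∑ U, lamb U * μ.real (W ∩ {ω | openCluster ω a ∈ U.1}) = ∑ U, K a U * lamb U :=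
      Finset.sum_congr rfl fun U _ => by rw [hK, inter_comm, mul_comm]
    have hRo : ∑ U, lamb U * μ.real (W ∩ {ω | openCluster ω o ∈ U.1}) = ∑ U, R U * lamb U :=
      Finset.sum_congr rfl fun U _ => by rw [hR, inter_comm, mul_comm]
    rw [hKa, hRo] at hle
    linarith [hrelay ⟨a, haA⟩, htgt, hle]

/-- **Question 5 from the universal coefficients**: the up-set `{S ∋ b}` gives `Σ_a c_a P(a ↔ b, 0 ↔ A) ≤ P(0 ↔ b, 0 ↔ A)` for every `b`, with the
SAME `c` (and, here, the same `c` also serves every other increasing cluster event). [cite: KozmaNitzan2024, Question 5 (p. 32)] -/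
theorem kn_question5_of_universal (w : Sym2 (Fin n) → unitInterval) (A : Finset (Fin n)) (o : Fin n) (hA : A.Nonempty) :
    ∃ c : Fin n → ℝ, (∀ a, 0 ≤ c a) ∧ ∑ a ∈ A, c a = 1 ∧
      (∀ 𝒰 : Set (Set (Fin n)), IsUpperSet 𝒰 →
        ∑ a ∈ A, c a * (prodBernoulli w).real ({ω | openCluster ω a ∈ 𝒰} ∩ ⋃ a' ∈ A, openConn o a') ≤
          (prodBernoulli w).real ({ω | openCluster ω o ∈ 𝒰} ∩ ⋃ a' ∈ A, openConn o a')) ∧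
      ∀ b : Fin n, ∑ a ∈ A, c a * (prodBernoulli w).real (openConn a b ∩ ⋃ a' ∈ A, openConn o a') ≤
        (prodBernoulli w).real (openConn o b ∩ ⋃ a' ∈ A, openConn o a') := by
  obtain ⟨c, hc0, hc1, hcU⟩ := universal_upset_coefficients w A o hA
  refine ⟨c, hc0, hc1, hcU, fun b => ?_⟩
  have hup : IsUpperSet ({S : Set (Fin n) | b ∈ S}) := fun S T hST hS => hST hS
  have hev : ∀ x : Fin n, ({ω : BondConfig (Fin n) | openCluster ω x ∈ {S : Set (Fin n) | b ∈ S}}) = openConn x b := by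
    intro x; ext ω; rfl
  have h := hcU {S : Set (Fin n) | b ∈ S} hup
  simp only [hev] at h
  exact h

/-- Peeling one layer: if `F = F' + δ·1_𝒰` pointwise then `∫_W F(C_x) = ∫_W F'(C_x) + δ·μ(W ∩ {C_x ∈ 𝒰})`. [folklore] -/
theorem setIntegral_peel (w : Sym2 (Fin n) → unitInterval) (W : Set (BondConfig (Fin n))) (F F' : Set (Fin n) → ℝ) (𝒰 : Set (Set (Fin n)))
    (δ : ℝ) (hFF' : ∀ S, F S = F' S + δ * 𝒰.indicator (1 : Set (Fin n) → ℝ) S) (x : Fin n) :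
    ∫ ω in W, F (openCluster ω x) ∂(prodBernoulli w) =
      ∫ ω in W, F' (openCluster ω x) ∂(prodBernoulli w) + δ * (prodBernoulli w).real (W ∩ {ω | openCluster ω x ∈ 𝒰}) := by
  set μ := prodBernoulli w with hμ
  have hint : ∀ (g : BondConfig (Fin n) → ℝ), Integrable g (μ.restrict W) := fun g => Integrable.of_finite
  have hfun : (fun ω : BondConfig (Fin n) => F (openCluster ω x)) =
      fun ω => F' (openCluster ω x) + δ * 𝒰.indicator (1 : Set (Fin n) → ℝ) (openCluster ω x) := funext fun ω => hFF' _
  rw [hfun, integral_add (hint _) (hint _), integral_const_mul]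
  congr 2
  have hind : (fun ω : BondConfig (Fin n) => 𝒰.indicator (1 : Set (Fin n) → ℝ) (openCluster ω x)) =
      ({ω : BondConfig (Fin n) | openCluster ω x ∈ 𝒰} : Set (BondConfig (Fin n))).indicator 1 := by
    funext ω
    by_cases h : ω ∈ ({ω : BondConfig (Fin n) | openCluster ω x ∈ 𝒰} : Set (BondConfig (Fin n)))
    · rw [indicator_of_mem h, Pi.one_apply, indicator_of_mem (show openCluster ω x ∈ 𝒰 from h), Pi.one_apply]
    · rw [indicator_of_notMem h, indicator_of_notMem (show openCluster ω x ∉ 𝒰 from h)]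
  rw [hind, KNPreFKG.setIntegral_indicator_one_eq]

/-- **UNIVERSAL GLUING COEFFICIENTS FOR EVERY MONOTONE CLUSTER PROPERTY** (Kozma–Nitzan's Conjecture 4 with ONE probability vector `c` on `A`
serving all monotone `F` simultaneously): on every finite weighted graph, for every `A ≠ ∅` and every `0` there is `c ≥ 0`, `Σ_{a∈A} c_a = 1`, with
`Σ_{a∈A} c_a · E[F(C_a); 0 ↔ A] ≤ E[F(C_0); 0 ↔ A]` for EVERY `F` monotone on vertex sets.  From `universal_upset_coefficients` by the layer-cake
decomposition of a monotone function on the finite lattice of vertex sets into its bottom value plus a nonnegative combination of up-set indicators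
(induction on the number of vertex sets above the bottom value; one layer = `setIntegral_peel`). [cite: KozmaNitzan2024, Conj. 4 and Question 5 (p. 32)] -/
theorem universal_coefficients (w : Sym2 (Fin n) → unitInterval) (A : Finset (Fin n)) (o : Fin n) (hA : A.Nonempty) :
    ∃ c : Fin n → ℝ, (∀ a, 0 ≤ c a) ∧ ∑ a ∈ A, c a = 1 ∧
      ∀ F : Set (Fin n) → ℝ, (∀ S T : Set (Fin n), S ⊆ T → F S ≤ F T) →
        ∑ a ∈ A, c a * ∫ ω in ⋃ a' ∈ A, openConn o a', F (openCluster ω a) ∂(prodBernoulli w) ≤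
          ∫ ω in ⋃ a' ∈ A, openConn o a', F (openCluster ω o) ∂(prodBernoulli w) := by
  obtain ⟨c, hc0, hc1, hcU⟩ := universal_upset_coefficients w A o hA
  refine ⟨c, hc0, hc1, ?_⟩
  set μ := prodBernoulli w with hμ
  set W : Set (BondConfig (Fin n)) := ⋃ a' ∈ A, openConn o a' with hW
  -- induction on the number of vertex sets where `F` exceeds its bottom value `F ∅`
  suffices h : ∀ (k : ℕ) (F : Set (Fin n) → ℝ), (∀ S T : Set (Fin n), S ⊆ T → F S ≤ F T) →
      (Finset.univ.filter fun S : Set (Fin n) => F S ≠ F ∅).card ≤ k →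
      ∑ a ∈ A, c a * ∫ ω in W, F (openCluster ω a) ∂μ ≤ ∫ ω in W, F (openCluster ω o) ∂μ by
    intro F hF; exact h _ F hF le_rfl
  intro k
  induction k with
  | zero =>
    intro F hF hk
    -- `F` is constant
    have hconst : ∀ S, F S = F ∅ := by
      intro S
      by_contra hS
      have hmem : S ∈ Finset.univ.filter fun S : Set (Fin n) => F S ≠ F ∅ := Finset.mem_filter.2 ⟨Finset.mem_univ _, hS⟩
      have : 0 < (Finset.univ.filter fun S : Set (Fin n) => F S ≠ F ∅).card := Finset.card_pos.2 ⟨S, hmem⟩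
      omega
    have hI : ∀ x : Fin n, ∫ ω in W, F (openCluster ω x) ∂μ = μ.real W * F ∅ := by
      intro x
      simp_rw [hconst]
      rw [setIntegral_const, smul_eq_mul]
    simp_rw [hI]
    rw [← Finset.sum_mul, hc1, one_mul]
  | succ k ih =>
    intro F hF hk
    by_cases hne : (Finset.univ.filter fun S : Set (Fin n) => F S ≠ F ∅).Nonempty
    swap
    · rw [Finset.not_nonempty_iff_eq_empty] at hne
      exact ih F hF (by rw [hne, Finset.card_empty]; exact Nat.zero_le _)
    -- bottom value `m = F ∅`, next value `t`, gap `t - m > 0`, bottom layer `{F ≠ m}` (an up-set)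
    have hbot : ∀ S, F ∅ ≤ F S := fun S => hF ∅ S (empty_subset S)
    obtain ⟨S₀, hS₀Φ, ht⟩ := Finset.exists_mem_eq_inf' hne F
    set t : ℝ := (Finset.univ.filter fun S : Set (Fin n) => F S ≠ F ∅).inf' hne F with htdef
    have hS₀ : F S₀ ≠ F ∅ := (Finset.mem_filter.1 hS₀Φ).2
    have htle : ∀ S, F S ≠ F ∅ → t ≤ F S := fun S hS => Finset.inf'_le F (Finset.mem_filter.2 ⟨Finset.mem_univ _, hS⟩)
    have hδ : 0 < t - F ∅ := by
      rw [ht]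
      rcases (hbot S₀).lt_or_eq with hlt | heq
      · linarith
      · exact absurd heq.symm hS₀
    have h𝒰up : IsUpperSet ({S : Set (Fin n) | F S ≠ F ∅}) := by
      intro S T hST hS hT
      have h1 : F S ≤ F T := hF S T hST
      have h2 := hbot S
      exact hS (le_antisymm (le_of_le_of_eq h1 hT) h2)
    -- the peeled functional `F' S = max (F S - (t - m)) m`
    have hF'mono : ∀ S T : Set (Fin n), S ⊆ T → max (F S - (t - F ∅)) (F ∅) ≤ max (F T - (t - F ∅)) (F ∅) :=
      fun S T hST => max_le_max (sub_le_sub_right (hF S T hST) _) le_rfl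
    have hF'empty : max (F ∅ - (t - F ∅)) (F ∅) = F ∅ := max_eq_right (by linarith)
    have hF'val : ∀ S, F S ≠ F ∅ → max (F S - (t - F ∅)) (F ∅) = F S - (t - F ∅) :=
      fun S hS => max_eq_left (by linarith [htle S hS])
    have hFF' : ∀ S, F S = max (F S - (t - F ∅)) (F ∅) + (t - F ∅) * ({S : Set (Fin n) | F S ≠ F ∅}).indicator (1 : Set (Fin n) → ℝ) S := by
      intro S
      by_cases hS : F S ≠ F ∅
      · rw [indicator_of_mem (show S ∈ {S : Set (Fin n) | F S ≠ F ∅} from hS), Pi.one_apply, mul_one, hF'val S hS]; ring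
      · rw [indicator_of_notMem (show S ∉ {S : Set (Fin n) | F S ≠ F ∅} from hS), mul_zero, add_zero]
        push Not at hS
        rw [hS, hF'empty]
    -- fewer vertex sets above the bottom for `F'`: `S₀` dropped out
    have hcard : (Finset.univ.filter fun S : Set (Fin n) =>
        max (F S - (t - F ∅)) (F ∅) ≠ max (F ∅ - (t - F ∅)) (F ∅)).card ≤ k := by
      have hsub : (Finset.univ.filter fun S : Set (Fin n) => max (F S - (t - F ∅)) (F ∅) ≠ max (F ∅ - (t - F ∅)) (F ∅)) ⊆
          (Finset.univ.filter fun S : Set (Fin n) => F S ≠ F ∅).erase S₀ := by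
        intro S hS
        rw [Finset.mem_filter] at hS
        have hS2 := hS.2
        rw [hF'empty] at hS2
        rw [Finset.mem_erase, Finset.mem_filter]
        refine ⟨?_, Finset.mem_univ _, ?_⟩
        · rintro rfl
          rw [hF'val S hS₀, ← ht] at hS2
          exact hS2 (by ring)
        · intro hS3
          rw [hS3, hF'empty] at hS2
          exact hS2 rfl
      have h1 := Finset.card_le_card hsub
      have h2 := Finset.card_erase_of_mem hS₀Φ
      omega
    have hih := ih (fun S => max (F S - (t - F ∅)) (F ∅)) hF'mono hcard
    have hU := hcU {S : Set (Fin n) | F S ≠ F ∅} h𝒰up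
    -- assemble by linearity
    have hpeel : ∀ x : Fin n, ∫ ω in W, F (openCluster ω x) ∂μ =
        ∫ ω in W, max (F (openCluster ω x) - (t - F ∅)) (F ∅) ∂μ +
          (t - F ∅) * μ.real (W ∩ {ω | openCluster ω x ∈ {S : Set (Fin n) | F S ≠ F ∅}}) :=
      fun x => setIntegral_peel w W F (fun S => max (F S - (t - F ∅)) (F ∅)) {S : Set (Fin n) | F S ≠ F ∅} (t - F ∅) hFF' x
    simp_rw [hpeel]
    have hsplit : ∑ a ∈ A, c a * (∫ ω in W, max (F (openCluster ω a) - (t - F ∅)) (F ∅) ∂μ +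
          (t - F ∅) * μ.real (W ∩ {ω | openCluster ω a ∈ {S : Set (Fin n) | F S ≠ F ∅}})) =
        ∑ a ∈ A, c a * ∫ ω in W, max (F (openCluster ω a) - (t - F ∅)) (F ∅) ∂μ +
          (t - F ∅) * ∑ a ∈ A, c a * μ.real ({ω | openCluster ω a ∈ {S : Set (Fin n) | F S ≠ F ∅}} ∩ W) := by
      rw [Finset.mul_sum, ← Finset.sum_add_distrib]
      refine Finset.sum_congr rfl fun a _ => ?_
      rw [inter_comm]; ring
    rw [hsplit, inter_comm]
    have := mul_le_mul_of_nonneg_left hU hδ.le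
    linarith

/-- **KOZMA–NITZAN'S QUESTION 5, answered affirmatively, in the printed form (display (38))**: on every finite graph with any weight vector, for
every `A ≠ ∅` and every `0` there are target-independent coefficients `c_a ≥ 0`, `Σ_{a∈A} c_a = 1`, with
`Σ_{a∈A} c_a · P(0 ↔ A, a ↔ b) ≤ P(0 ↔ b)` for EVERY vertex `b` ("If true, this will, of course, imply conjecture 2", p. 33; the authors' hitting-coefficient
approach "did not pan out").  Corollary of `universal_upset_coefficients` (the same `c` serves every increasing cluster event).
[cite: KozmaNitzan2024, Question 5 and display (38) (p. 32)] -/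
theorem kn_question5 (w : Sym2 (Fin n) → unitInterval) (A : Finset (Fin n)) (o : Fin n) (hA : A.Nonempty) :
    ∃ c : Fin n → ℝ, (∀ a, 0 ≤ c a) ∧ ∑ a ∈ A, c a = 1 ∧
      ∀ b : Fin n, ∑ a ∈ A, c a * (prodBernoulli w).real ((⋃ a' ∈ A, openConn o a') ∩ openConn a b) ≤
        (prodBernoulli w).real (openConn o b) := by
  obtain ⟨c, hc0, hc1, -, hcb⟩ := kn_question5_of_universal w A o hA
  refine ⟨c, hc0, hc1, fun b => ?_⟩
  have hmono : (prodBernoulli w).real (openConn o b ∩ ⋃ a' ∈ A, openConn o a') ≤ (prodBernoulli w).real (openConn o b) :=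
    measureReal_mono inter_subset_left
  calc ∑ a ∈ A, c a * (prodBernoulli w).real ((⋃ a' ∈ A, openConn o a') ∩ openConn a b)
      = ∑ a ∈ A, c a * (prodBernoulli w).real (openConn a b ∩ ⋃ a' ∈ A, openConn o a') :=
        Finset.sum_congr rfl fun a _ => by rw [inter_comm]
    _ ≤ (prodBernoulli w).real (openConn o b ∩ ⋃ a' ∈ A, openConn o a') := hcb b
    _ ≤ (prodBernoulli w).real (openConn o b) := hmono

end UniversalGluing

end Summit.CriticalPhenomena.PercolationContinuityZ3.Theorems

end
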